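import Literature.AnabelianGeometry.SemiGraphs.CharacteristicOpenCore
import Literature.AnabelianGeometry.SemiGraphs.TemperoidsResProofs
import Literature.AnabelianGeometry.SemiGraphs.TemperedQuasiCoherentOfLevels
import Literature.AnabelianGeometry.SemiGraphs.UniformSplittingStrictlyCoherentProofs
import Literature.AnabelianGeometry.SemiGraphs.TemperedGaloisCountableOfStrictlyCoherent
import Literature.AnabelianGeometry.SemiGraphs.ThetaRayGraph
import HarnessLib

/-!
# `𝒢_θ` (the ray semi-graph of anabelioids of the REFUTE-F1732 programme) is quasi-coherent, strictly
# coherent and Galois-countable, with its SPLITTER FAMILY named — brick R4 assembled in binder form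

Mochizuki, *Semi-graphs of anabelioids*, Publ. RIMS **42** (2006), Def. 2.3 (iii) p. 25 (approximators,
quasi-coherent, coherent), Prop. 2.5 p. 27 (trivialising coverings); [IUTchI] Rmk. 2.5.3 (i) (T2)–(T4)
pp. 52–53 (Galois-countable, strictly coherent) [cite: MochizukiSemiAnbd2006, Def 2.3(iii) p.25]; the
characteristic open subgroups of bounded index [cite: DixonEtAl1999, Prop 1.6]; abc-iut-L3-d1's desk
countermodel memo COUNTERMODEL-Thm37iii-infinite.md §3 (H4)/(H5) (sha16 8b26b5199c29f55f).

PROOF-ONLY file (abc-iut cell, FRONTIER programme SUBDAG-REFUTE-F1732, brick **R4**, seat abc-iut-w4-d075;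
theorems only, no definition; two lemmas of `CharacteristicOpenCoreRetraction.lean` are inlined as private
copies so that this module does not depend on that module's build).  GENERIC PART (any `𝒢 : ProfiniteSemiGraph`):
* `isQuasiCoherent_of_charOpenCore` — the vertex levels of the constructor
  `isQuasiCoherent_of_compatibleLevels` (`TemperedQuasiCoherentOfLevels.lean`) taken to be the
  CHARACTERISTIC OPEN CORES `charOpenCore Π_v M` (abc-iut-w4-d053): normal, open, of finite index when
  `Π_v` is topologically finitely generated, fixing every finite continuous `Π_v`-set with `≤ M` points
  (`ρ_eq_of_mem_charOpenCore`); left as hypotheses: a uniform index bound over the vertices and edge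
  levels `W_M(e)` of finite index to which EVERY abutting branch map pulls the cores back, fixing the
  small finite `Π_e`-sets (for a branch map with a continuous retraction:
  `charOpenCore_comap_fixes_of_leftInverse`);
* `exists_splitter_of_compatibleLevels` / `exists_splitter_of_charOpenCore` — the finite covering behind
  the approximator as a NAMED object of `B^cov(G)` with point stabilisers COMPUTED (exactly the levels;
  [SemiAnbd] Prop. 2.5), for the escape brick R6.
PART OVER abc-iut-w6-d070's OBJECT `ProfiniteSemiGraph.thetaRay G E up low` (`ThetaRayGraph.lean`, brick R3:
the ray, all vertex groups `G`, all edge groups `E`, glued by `up` at `β_k⁺` and `low k` at `β_k⁻`), in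
BINDER form (nothing of brick R1 is imported; its outputs are the named hypotheses):
* `thetaRay_isQuasiCoherent` — (H5): `G` topologically finitely generated, `up` with a continuous
  retraction `χ` (memo: the character `a ↦ 1, b ↦ 0`), and every `low k` pulling each `charOpenCore G M`
  back to the SAME subgroup of `E` as `up` (memo: `low k = θ_{n_k} ∘ up` for bi-continuous automorphisms
  `θ`, which fix the cores — `comap_charOpenCore_eq_of_mulEquiv`, from `map_charOpenCore_eq`):
  approximator `G / charOpenCore G M` at EVERY vertex, `E / up⁻¹(charOpenCore G M)` at every edge;
* `thetaRay_exists_splitter` — the splitter family `S_M` with point stabilisers EXACTLY `charOpenCore G M`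
  / `up⁻¹(charOpenCore G M)` (input (c2)/(c3) of R6);
* `thetaRay_isStrictlyCoherent` — (T3) from (H5) and finite topological generating sets of `G`, `E`;
* `thetaRay_isGaloisCountable` — (H4) = (T4) (`isGaloisCountable_of_isStrictlyCoherent`);
* `thetaRayOfTwists_…` — the memo's shape `low k = θ_{n_k} ∘ α`, `θ_m` continuous bijective endomorphisms
  (bi-continuous automatically: `G` compact Hausdorff).

HONEST FRAMING: hypotheses of a countermodel CANDIDATE to the ∀-countable typing of [SemiAnbd] Thm 3.7 (iii)
(F-1732); print proves finite 𝔾 (`compactInVerticialAt_of_finiteGraph`); nothing here bears on [IUTchIII]. -/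

namespace Literature.AnabelianGeometry.SemiGraphs

open Topology
open Literature.AnabelianGeometry.AbsoluteAnabelian (IsTopologicallyFinitelyGenerated)

universe u v

section Group

variable {Γ : Type u} [Group Γ] {Γ' : Type v} [Group Γ']

/-- A subgroup of finite index pulls back to a subgroup of finite index. [folklore] -/
private theorem index_comap_ne_zero_of_index_ne_zero (f : Γ' →* Γ) (H : Subgroup Γ) (hH : H.index ≠ 0) :
    (H.comap f).index ≠ 0 := by
  rw [Subgroup.index_comap]
  exact fun h0 => hH (Subgroup.index_eq_zero_of_relIndex_eq_zero h0)


/-- Private copy of `comap_charOpenCore_le_of_leftInverse` (`CharacteristicOpenCoreRetraction.lean`),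
inlined so that this module does not wait on that module's build. [cite: DixonEtAl1999, Prop 1.6] -/
private theorem comap_charOpenCore_le_of_leftInverse_aux [TopologicalSpace Γ] [TopologicalSpace Γ']
    (α : Γ' →* Γ) (χ : Γ →* Γ') (hχ : Continuous χ) (hχα : ∀ x, χ (α x) = x) (d : ℕ) :
    (charOpenCore Γ d).comap α ≤ charOpenCore Γ' d := by
  have hsurj : Function.Surjective χ := fun x => ⟨α x, hχα x⟩
  have hcore : charOpenCore Γ d ≤ (charOpenCore Γ' d).comap χ := by
    intro g hg
    rw [Subgroup.mem_comap, charOpenCore, Subgroup.mem_sInf]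
    rintro U ⟨hUo, hUi, hUd⟩
    have hU' : U.comap χ ∈ openSubgroupsIndexLE Γ d :=
      ⟨hUo.preimage hχ, by rw [Subgroup.index_comap_of_surjective U hsurj]; exact hUi,
        by rw [Subgroup.index_comap_of_surjective U hsurj]; exact hUd⟩
    exact charOpenCore_le hU' hg
  have h2 : ((charOpenCore Γ' d).comap χ).comap α = charOpenCore Γ' d := by
    rw [Subgroup.comap_comap, show χ.comp α = MonoidHom.id Γ' from MonoidHom.ext hχα, Subgroup.comap_id]
  exact (Subgroup.comap_mono hcore).trans h2.le

/-- Private copy of `ρ_eq_of_mem_charOpenCore` (`CharacteristicOpenCoreRetraction.lean`): the core of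
level `d` fixes every finite continuous set with `≤ d` points. [cite: DixonEtAl1999, Prop 1.6] -/
private theorem ρ_eq_of_mem_charOpenCore_aux [TopologicalSpace Γ] (X : BTemp Γ) [Finite X.obj.V] {d : ℕ}
    (hd : Nat.card X.obj.V ≤ d) {g : Γ} (hg : g ∈ charOpenCore Γ d) (x : X.obj.V) : X.obj.ρ g x = x := by
  letI : MulAction Γ X.obj.V := Action.instMulAction X.obj
  have hstab : BTemp.stab X x = MulAction.stabilizer Γ x :=
    le_antisymm (fun g hg => hg) (fun g hg => hg)
  have h2 : (MulAction.stabilizer Γ x).index = Nat.card (MulAction.orbit Γ x) :=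
    Nat.card_congr (MulAction.orbitEquivQuotientStabilizer Γ x).symm
  have h3 : Nat.card (MulAction.orbit Γ x) ≤ Nat.card X.obj.V :=
    Nat.card_le_card_of_injective (fun y : MulAction.orbit Γ x => (y : X.obj.V)) Subtype.val_injective
  have h4 : Nat.card (MulAction.orbit Γ x) ≠ 0 :=
    Nat.card_ne_zero.mpr ⟨⟨⟨x, MulAction.mem_orbit_self x⟩⟩, inferInstance⟩
  have hmem : BTemp.stab X x ∈ openSubgroupsIndexLE Γ d :=
    ⟨X.property.2 x, by rw [hstab, h2]; exact Nat.pos_of_ne_zero h4, by rw [hstab, h2]; exact h3.trans hd⟩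
  exact charOpenCore_le hmem hg

variable [TopologicalSpace Γ] [TopologicalSpace Γ']

/-- **Retraction packaging.**  If the branch map `α : Π_e → Π_v` has a continuous left inverse, then
`α⁻¹(charOpenCore Π_v M)` fixes every finite continuous `Π_e`-set with at most `M` points.
[cite: DixonEtAl1999, Prop 1.6] -/
theorem charOpenCore_comap_fixes_of_leftInverse (α : Γ' →* Γ) (χ : Γ →* Γ') (hχ : Continuous χ)
    (hχα : ∀ x, χ (α x) = x) (M : ℕ) (X : BTemp Γ') [Finite X.obj.V] (hX : Nat.card X.obj.V ≤ M)
    {g : Γ'} (hg : g ∈ (charOpenCore Γ M).comap α) (x : X.obj.V) : X.obj.ρ g x = x :=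
  ρ_eq_of_mem_charOpenCore_aux X hX (comap_charOpenCore_le_of_leftInverse_aux α χ hχ hχα M hg) x

end Group

namespace ProfiniteSemiGraph

variable {𝒢 : ProfiniteSemiGraph.{u}}

/-- **Quasi-coherence from characteristic open cores** ([SemiAnbd] Def. 2.3 (iii), binder form for
concrete semi-graphs of anabelioids): topologically finitely generated vertex groups with uniformly
bounded core indices, and edge levels `W_M(e)` of finite index receiving `charOpenCore Π_v M` under EVERY
abutting branch map and fixing the small finite `Π_e`-sets, make `G` quasi-coherent.
[cite: MochizukiSemiAnbd2006, Def 2.3(iii) p.25] -/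
theorem isQuasiCoherent_of_charOpenCore
    (htfg : ∀ v : 𝒢.graph.Vertex, IsTopologicallyFinitelyGenerated (𝒢.Gv v))
    (hbound : ∀ M : ℕ, ∃ B : ℕ, ∀ v : 𝒢.graph.Vertex, (charOpenCore (𝒢.Gv v) M).index ≤ B)
    (W : ℕ → ∀ e : 𝒢.graph.Edge, Subgroup (𝒢.Ge e))
    (hWn : ∀ M e, (W M e).Normal) (hWo : ∀ M e, IsOpen (W M e : Set (𝒢.Ge e)))
    (hWi : ∀ M e, (W M e).index ≠ 0)
    (hcomp : ∀ M (b : 𝒢.graph.Branch) (v : 𝒢.graph.Vertex) (h : 𝒢.graph.abuts b = some v),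
      (charOpenCore (𝒢.Gv v) M).comap (𝒢.brHom b v h).toMonoidHom = W M (𝒢.graph.edgeOf b))
    (hWfix : ∀ M e (X : BTemp (𝒢.Ge e)), Finite X.obj.V → Nat.card X.obj.V ≤ M →
      ∀ g ∈ W M e, ∀ x : X.obj.V, X.obj.ρ g x = x) :
    𝒢.IsQuasiCoherent := by
  refine isQuasiCoherent_of_compatibleLevels (fun M v => charOpenCore (𝒢.Gv v) M) W
    (fun M v => charOpenCore_normal (Γ := 𝒢.Gv v) M) hWn
    (fun M v => isOpen_charOpenCore_of_tfg (htfg v) M) hWo ?_ hWi hcomp ?_ hWfix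
  · intro M
    obtain ⟨B, hB⟩ := hbound M
    exact ⟨B, fun v => ⟨(finiteIndex_charOpenCore_of_tfg (htfg v) M).index_ne_zero, hB v⟩⟩
  · intro M v X hXfin hX g hg x
    haveI := hXfin
    exact ρ_eq_of_mem_charOpenCore_aux X hX hg x

/-- **A NAMED splitter at one level** (the finite étale covering behind the approximator of
`isQuasiCoherent_of_compatibleLevels`, with its point stabilisers COMPUTED): given open normal
finite-index levels `U(v) ⊴ Π_v` (indices bounded uniformly in `v`), `W(e) ⊴ Π_e`, with every branch map
pulling `U(v)` back to exactly `W(e)`, there is a finite object `S` of `B^cov(G)` with nonempty fibres whose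
point stabilisers are EXACTLY `U(v)` at every vertex and `W(e)` at every edge — the trivialising covering
([SemiAnbd] Prop. 2.5) of the approximator `Π_v/U(v)`, `Π_e/W(e)`.  (Consumed by the escape brick R6 of the
programme: "the canonical tower dominates the splitters".) [cite: MochizukiSemiAnbd2006, Prop 2.5 p.27] -/
theorem exists_splitter_of_compatibleLevels
    (U : ∀ v : 𝒢.graph.Vertex, Subgroup (𝒢.Gv v)) (W : ∀ e : 𝒢.graph.Edge, Subgroup (𝒢.Ge e))
    (hUn : ∀ v, (U v).Normal) (hWn : ∀ e, (W e).Normal)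
    (hUo : ∀ v, IsOpen (U v : Set (𝒢.Gv v))) (hWo : ∀ e, IsOpen (W e : Set (𝒢.Ge e)))
    (hUi : ∃ B : ℕ, ∀ v, (U v).index ≠ 0 ∧ (U v).index ≤ B) (hWi : ∀ e, (W e).index ≠ 0)
    (hcomp : ∀ (b : 𝒢.graph.Branch) (v : 𝒢.graph.Vertex) (h : 𝒢.graph.abuts b = some v),
      (U v).comap (𝒢.brHom b v h).toMonoidHom = W (𝒢.graph.edgeOf b)) :
    ∃ S : CovObj 𝒢, S.IsFinite ∧ S.HasNonemptyFibres ∧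
      (∀ (v : 𝒢.graph.Vertex) (z : (S.SV v).obj.V) (g : 𝒢.Gv v), (S.SV v).obj.ρ g z = z ↔ g ∈ U v) ∧
      (∀ (e : 𝒢.graph.Edge) (z : (S.SE e).obj.V) (g : 𝒢.Ge e), (S.SE e).obj.ρ g z = z ↔ g ∈ W e) := by
  obtain ⟨B, hB⟩ := hUi
  haveI : ∀ v, (U v).Normal := hUn
  haveI : ∀ e, (W e).Normal := hWn
  haveI : ∀ v, (U v).FiniteIndex := fun v => ⟨(hB v).1⟩
  haveI : ∀ e, (W e).FiniteIndex := fun e => ⟨hWi e⟩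
  have hle : ∀ (b : 𝒢.graph.Branch) (v : 𝒢.graph.Vertex) (h : 𝒢.graph.abuts b = some v),
      W (𝒢.graph.edgeOf b) ≤ (U v).comap (𝒢.brHom b v h).toMonoidHom :=
    fun b v h => (hcomp b v h).ge
  let A : 𝒢.Approximator :=
    { FV := fun v => 𝒢.Gv v ⧸ U v
      FE := fun e => 𝒢.Ge e ⧸ W e
      πV := fun v => QuotientGroup.mk' (U v)
      πE := fun e => QuotientGroup.mk' (W e)
      isOpen_ker_πV := fun v => by rw [QuotientGroup.ker_mk']; exact hUo v
      isOpen_ker_πE := fun e => by rw [QuotientGroup.ker_mk']; exact hWo e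
      brF := fun b v h => QuotientGroup.map (W (𝒢.graph.edgeOf b)) (U v) (𝒢.brHom b v h).toMonoidHom (hle b v h)
      brF_injective := fun b v h => by
        rw [injective_iff_map_eq_one]
        intro a ha
        obtain ⟨g, rfl⟩ := QuotientGroup.mk_surjective a
        rw [QuotientGroup.map_mk, QuotientGroup.eq_one_iff] at ha
        rw [QuotientGroup.eq_one_iff, ← hcomp b v h]
        exact ha
      comm := fun b v h => ⟨1, fun x => by
        rw [one_mul, inv_one, mul_one]
        rfl⟩
      bounded := ⟨B.factorial, Nat.factorial_pos B, fun v =>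
        Nat.dvd_factorial (Nat.pos_of_ne_zero (hB v).1) (hB v).2⟩ }
  obtain ⟨M, hM, hdvd⟩ := A.bounded
  refine ⟨A.trivCov hM hdvd, A.trivCov_isFinite hM hdvd, A.trivCov_hasNonemptyFibres hM hdvd,
    fun v z g => ⟨fun hz => ?_, fun hg => ?_⟩, fun e z g => ⟨fun hz => ?_, fun hg => ?_⟩⟩
  · exact (QuotientGroup.eq_one_iff g).mp (CovObj.πV_eq_one_of_trivCov_ρ_eq A hM hdvd v z g hz)
  · have h1 : A.πV v g = 1 := (QuotientGroup.eq_one_iff g).mpr hg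
    change (A.πV v g * z.1, z.2) = z
    rw [h1, one_mul, Prod.mk.eta]
  · exact (QuotientGroup.eq_one_iff g).mp (CovObj.πE_eq_one_of_trivCov_ρ_eq A hM hdvd e z g hz)
  · have h1 : A.πE e g = 1 := (QuotientGroup.eq_one_iff g).mpr hg
    change (A.πE e g * z.1, z.2) = z
    rw [h1, one_mul, Prod.mk.eta]

/-- **The characteristic-open-core splitter** `S_M`: for topologically finitely generated vertex groups
with uniformly bounded core indices and compatible edge levels `W_M(e)` (as in
`isQuasiCoherent_of_charOpenCore`), a finite covering with nonempty fibres whose point stabilisers are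
EXACTLY `charOpenCore Π_v M` at the vertices and `W_M(e)` at the edges.
[cite: MochizukiSemiAnbd2006, Prop 2.5 p.27] -/
theorem exists_splitter_of_charOpenCore
    (htfg : ∀ v : 𝒢.graph.Vertex, IsTopologicallyFinitelyGenerated (𝒢.Gv v)) (M : ℕ)
    (hbound : ∃ B : ℕ, ∀ v : 𝒢.graph.Vertex, (charOpenCore (𝒢.Gv v) M).index ≤ B)
    (W : ∀ e : 𝒢.graph.Edge, Subgroup (𝒢.Ge e)) (hWn : ∀ e, (W e).Normal)
    (hWo : ∀ e, IsOpen (W e : Set (𝒢.Ge e))) (hWi : ∀ e, (W e).index ≠ 0)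
    (hcomp : ∀ (b : 𝒢.graph.Branch) (v : 𝒢.graph.Vertex) (h : 𝒢.graph.abuts b = some v),
      (charOpenCore (𝒢.Gv v) M).comap (𝒢.brHom b v h).toMonoidHom = W (𝒢.graph.edgeOf b)) :
    ∃ S : CovObj 𝒢, S.IsFinite ∧ S.HasNonemptyFibres ∧
      (∀ (v : 𝒢.graph.Vertex) (z : (S.SV v).obj.V) (g : 𝒢.Gv v),
        (S.SV v).obj.ρ g z = z ↔ g ∈ charOpenCore (𝒢.Gv v) M) ∧
      (∀ (e : 𝒢.graph.Edge) (z : (S.SE e).obj.V) (g : 𝒢.Ge e), (S.SE e).obj.ρ g z = z ↔ g ∈ W e) := by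
  obtain ⟨B, hB⟩ := hbound
  exact exists_splitter_of_compatibleLevels (fun v => charOpenCore (𝒢.Gv v) M) W
    (fun v => charOpenCore_normal (Γ := 𝒢.Gv v) M) hWn (fun v => isOpen_charOpenCore_of_tfg (htfg v) M) hWo
    ⟨B, fun v => ⟨(finiteIndex_charOpenCore_of_tfg (htfg v) M).index_ne_zero, hB v⟩⟩ hWi hcomp

end ProfiniteSemiGraph

section Core

variable {G : Type} [Group G] [TopologicalSpace G]

/-- A bi-continuous automorphism pulls each characteristic open core back to itself
(`map_charOpenCore_eq` for the inverse). [cite: DixonEtAl1999, Prop 1.6] -/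
theorem comap_charOpenCore_eq_of_mulEquiv (e : G ≃* G) (he : Continuous e) (he' : Continuous e.symm)
    (d : ℕ) : (charOpenCore G d).comap e.toMonoidHom = charOpenCore G d := by
  rw [Subgroup.comap_equiv_eq_map_symm']
  exact map_charOpenCore_eq e.symm he' (by simpa using he)

/-- The same for a continuous BIJECTIVE endomorphism of a compact Hausdorff group (its inverse is
automatically continuous). [cite: DixonEtAl1999, Prop 1.6] -/
theorem comap_charOpenCore_eq_of_bijective [CompactSpace G] [T2Space G] (θ : G →ₜ* G)
    (hθ : Function.Bijective θ) (d : ℕ) :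
    (charOpenCore G d).comap θ.toMonoidHom = charOpenCore G d := by
  let e : G ≃* G := MulEquiv.ofBijective θ.toMonoidHom hθ
  have he : Continuous e := map_continuous θ
  have he' : Continuous e.symm :=
    Continuous.continuous_symm_of_equiv_compact_to_t2 (f := e.toEquiv) he
  have h := comap_charOpenCore_eq_of_mulEquiv e he he' d
  exact h

end Core

namespace ProfiniteSemiGraph

section ThetaRay

variable (G E : Type) [Group G] [TopologicalSpace G] [IsTopologicalGroup G] [CompactSpace G]
  [TotallyDisconnectedSpace G] [Group E] [TopologicalSpace E] [IsTopologicalGroup E] [CompactSpace E]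
  [TotallyDisconnectedSpace E] (up : E →ₜ* G) (low : ℕ → (E →ₜ* G))

/-- **(H5) `𝒢_θ` is quasi-coherent** ([SemiAnbd] Def. 2.3 (iii)), binder form: `G` topologically finitely
generated, `up` with a continuous retraction `χ`, and every `low k` pulling the characteristic open cores of
`G` back to the same subgroup of `E` as `up`. [cite: MochizukiSemiAnbd2006, Def 2.3(iii) p.25] -/
theorem thetaRay_isQuasiCoherent (htfg : IsTopologicallyFinitelyGenerated G) (χ : G →* E)
    (hχ : Continuous χ) (hχup : ∀ x, χ (up x) = x)
    (hlow : ∀ M k, (charOpenCore G M).comap (low k).toMonoidHom =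
      (charOpenCore G M).comap up.toMonoidHom) :
    (thetaRay G E up low).IsQuasiCoherent := by
  refine isQuasiCoherent_of_charOpenCore (𝒢 := thetaRay G E up low) (fun _ => htfg)
    (fun M => ⟨(charOpenCore G M).index, fun _ => le_rfl⟩)
    (fun M _ => (charOpenCore G M).comap up.toMonoidHom) ?_ ?_ ?_ ?_ ?_
  · intro M e
    haveI : (charOpenCore G M).Normal := charOpenCore_normal (Γ := G) M
    exact Subgroup.normal_comap _
  · intro M e
    exact (isOpen_charOpenCore_of_tfg htfg M).preimage (map_continuous up)
  · intro M e
    exact index_comap_ne_zero_of_index_ne_zero _ _ (finiteIndex_charOpenCore_of_tfg htfg M).index_ne_zero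
  · intro M b v h
    obtain ⟨k, c⟩ := b
    cases c
    · exact hlow M k
    · rfl
  · intro M e X hXfin hX g hg x
    haveI := hXfin
    exact charOpenCore_comap_fixes_of_leftInverse up.toMonoidHom χ hχ hχup M X hX hg x

/-- **The splitter family of `𝒢_θ`** (for the escape brick R6): for every `M`, a finite covering
`S_M` of `𝒢_θ` with nonempty fibres whose point stabilisers are EXACTLY `charOpenCore G M` at every vertex
and `up⁻¹(charOpenCore G M)` at every edge; `charOpenCore G M` is open, normal, of finite index, fixed by
every bi-continuous automorphism (`map_charOpenCore_eq`) and lies in every open subgroup of index `≤ M`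
(`charOpenCore_le`). [cite: MochizukiSemiAnbd2006, Prop 2.5 p.27] -/
theorem thetaRay_exists_splitter (htfg : IsTopologicallyFinitelyGenerated G)
    (hlow : ∀ M k, (charOpenCore G M).comap (low k).toMonoidHom =
      (charOpenCore G M).comap up.toMonoidHom) (M : ℕ) :
    ∃ S : CovObj (thetaRay G E up low), S.IsFinite ∧ S.HasNonemptyFibres ∧
      (∀ (v : ℕ) (z : (S.SV v).obj.V) (g : G), (S.SV v).obj.ρ g z = z ↔ g ∈ charOpenCore G M) ∧
      (∀ (e : ℕ) (z : (S.SE e).obj.V) (g : E),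
        (S.SE e).obj.ρ g z = z ↔ g ∈ (charOpenCore G M).comap up.toMonoidHom) := by
  refine exists_splitter_of_charOpenCore (𝒢 := thetaRay G E up low) (fun _ => htfg) M
    ⟨(charOpenCore G M).index, fun _ => le_rfl⟩ (fun _ => (charOpenCore G M).comap up.toMonoidHom)
    ?_ ?_ ?_ ?_
  · intro e
    haveI : (charOpenCore G M).Normal := charOpenCore_normal (Γ := G) M
    exact Subgroup.normal_comap _
  · intro e
    exact (isOpen_charOpenCore_of_tfg htfg M).preimage (map_continuous up)
  · intro e
    exact index_comap_ne_zero_of_index_ne_zero _ _ (finiteIndex_charOpenCore_of_tfg htfg M).index_ne_zero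
  · intro b v h
    obtain ⟨k, c⟩ := b
    cases c
    · exact hlow M k
    · rfl

/-- **(T3) `𝒢_θ` is strictly coherent** given (H5) and finite topological generating sets of `G` and `E`
(the bound is `N := max 1 (max |s_G| |s_E|)`). [cite: Mochizuki2012, IUTchI Rem. 2.5.3(i)(T3) p.53] -/
theorem thetaRay_isStrictlyCoherent (hqc : (thetaRay G E up low).IsQuasiCoherent) (sG : Finset G)
    (hsG : (Subgroup.closure (sG : Set G)).topologicalClosure = ⊤) (sE : Finset E)
    (hsE : (Subgroup.closure (sE : Set E)).topologicalClosure = ⊤) :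
    (thetaRay G E up low).IsStrictlyCoherent := by
  refine ⟨⟨hqc, fun _ => ⟨sG, hsG⟩, fun _ => ⟨sE, hsE⟩⟩, max 1 (max sG.card sE.card), le_max_left _ _,
    fun _ => ⟨sG, ?_, hsG⟩, fun _ => ⟨sE, ?_, hsE⟩⟩
  · exact (le_max_left _ _).trans (le_max_right _ _)
  · exact (le_max_right _ _).trans (le_max_right _ _)

/-- **(H4) `𝒢_θ` is Galois-countable** ([IUTchI] Rmk. 2.5.3 (i) (T2)), from (H5) and topological finite
generation of `G`, `E`, by (T4) in the local presentation (`isGaloisCountable_of_isStrictlyCoherent`).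
[cite: Mochizuki2012, IUTchI Rem. 2.5.3(i)(T4) p.53] -/
theorem thetaRay_isGaloisCountable (hqc : (thetaRay G E up low).IsQuasiCoherent) (sG : Finset G)
    (hsG : (Subgroup.closure (sG : Set G)).topologicalClosure = ⊤) (sE : Finset E)
    (hsE : (Subgroup.closure (sE : Set E)).topologicalClosure = ⊤) :
    (thetaRay G E up low).IsGaloisCountable :=
  isGaloisCountable_of_isStrictlyCoherent (thetaRay_isConnected G E up low) (thetaRay_hasVertex G E up low)
    (thetaRay_isCountable G E up low) (thetaRay_isStrictlyCoherent G E up low hqc sG hsG sE hsE)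

/-- **R4 packaged for `thetaRay`**: (H5) ∧ (T3) ∧ (H4) from the binder-form inputs of
`thetaRay_isQuasiCoherent` plus a finite topological generating set of `E`.
[cite: MochizukiSemiAnbd2006, Def 2.3(iii) p.25] -/
theorem thetaRay_isQuasiCoherent_isGaloisCountable (sG : Finset G)
    (hsG : (Subgroup.closure (sG : Set G)).topologicalClosure = ⊤) (sE : Finset E)
    (hsE : (Subgroup.closure (sE : Set E)).topologicalClosure = ⊤) (χ : G →* E) (hχ : Continuous χ)
    (hχup : ∀ x, χ (up x) = x)
    (hlow : ∀ M k, (charOpenCore G M).comap (low k).toMonoidHom =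
      (charOpenCore G M).comap up.toMonoidHom) :
    (thetaRay G E up low).IsQuasiCoherent ∧ (thetaRay G E up low).IsStrictlyCoherent ∧
      (thetaRay G E up low).IsGaloisCountable := by
  have hqc := thetaRay_isQuasiCoherent G E up low ⟨sG, hsG⟩ χ hχ hχup hlow
  exact ⟨hqc, thetaRay_isStrictlyCoherent G E up low hqc sG hsG sE hsE,
    thetaRay_isGaloisCountable G E up low hqc sG hsG sE hsE⟩

end ThetaRay

section Twists

variable (G E : Type) [Group G] [TopologicalSpace G] [IsTopologicalGroup G] [CompactSpace G]
  [TotallyDisconnectedSpace G] [Group E] [TopologicalSpace E] [IsTopologicalGroup E] [CompactSpace E]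
  [TotallyDisconnectedSpace E] (α : E →ₜ* G) (θ : ℕ → (G →ₜ* G)) (n : ℕ → ℕ)

omit [IsTopologicalGroup G] [TotallyDisconnectedSpace G] [IsTopologicalGroup E] [CompactSpace E]
  [TotallyDisconnectedSpace E] in
/-- For the memo's shape `low k = θ_{n_k} ∘ α` with bijective continuous `θ_m` (bi-continuous
automorphisms of the compact Hausdorff `G`), the cores pull back along `low k` exactly as along `α`.
[cite: MochizukiSemiAnbd2006, Def 2.3(iii) p.25] -/
theorem thetaRayOfTwists_hlow [T2Space G] (hθ : ∀ k, Function.Bijective (θ (n k))) (M k : ℕ) :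
    (charOpenCore G M).comap ((θ (n k)).comp α).toMonoidHom = (charOpenCore G M).comap α.toMonoidHom := by
  have h1 : ((θ (n k)).comp α).toMonoidHom = (θ (n k)).toMonoidHom.comp α.toMonoidHom := rfl
  rw [h1, ← Subgroup.comap_comap, comap_charOpenCore_eq_of_bijective (θ (n k)) (hθ k) M]

/-- **The splitter family of `𝒢_θ` with twists.** [cite: MochizukiSemiAnbd2006, Prop 2.5 p.27] -/
theorem thetaRayOfTwists_exists_splitter [T2Space G] (htfg : IsTopologicallyFinitelyGenerated G)
    (hθ : ∀ k, Function.Bijective (θ (n k))) (M : ℕ) :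
    ∃ S : CovObj (thetaRayOfTwists G E α θ n), S.IsFinite ∧ S.HasNonemptyFibres ∧
      (∀ (v : ℕ) (z : (S.SV v).obj.V) (g : G), (S.SV v).obj.ρ g z = z ↔ g ∈ charOpenCore G M) ∧
      (∀ (e : ℕ) (z : (S.SE e).obj.V) (g : E),
        (S.SE e).obj.ρ g z = z ↔ g ∈ (charOpenCore G M).comap α.toMonoidHom) :=
  thetaRay_exists_splitter G E α _ htfg (thetaRayOfTwists_hlow G E α θ n hθ) M

/-- **(H5) for `𝒢_θ` with twists**: `G` topologically finitely generated, `α` with a continuous retraction,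
`θ_{n_k}` bijective. [cite: MochizukiSemiAnbd2006, Def 2.3(iii) p.25] -/
theorem thetaRayOfTwists_isQuasiCoherent [T2Space G] (htfg : IsTopologicallyFinitelyGenerated G)
    (χ : G →* E) (hχ : Continuous χ) (hχα : ∀ x, χ (α x) = x) (hθ : ∀ k, Function.Bijective (θ (n k))) :
    (thetaRayOfTwists G E α θ n).IsQuasiCoherent :=
  thetaRay_isQuasiCoherent G E α _ htfg χ hχ hχα (thetaRayOfTwists_hlow G E α θ n hθ)

/-- **(H4) ∧ (T3) ∧ (H5) for `𝒢_θ` with twists** (brick R4 for the memo's object).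
[cite: Mochizuki2012, IUTchI Rem. 2.5.3(i)(T4) p.53] -/
theorem thetaRayOfTwists_isQuasiCoherent_isGaloisCountable [T2Space G] (sG : Finset G)
    (hsG : (Subgroup.closure (sG : Set G)).topologicalClosure = ⊤) (sE : Finset E)
    (hsE : (Subgroup.closure (sE : Set E)).topologicalClosure = ⊤) (χ : G →* E) (hχ : Continuous χ)
    (hχα : ∀ x, χ (α x) = x) (hθ : ∀ k, Function.Bijective (θ (n k))) :
    (thetaRayOfTwists G E α θ n).IsQuasiCoherent ∧ (thetaRayOfTwists G E α θ n).IsStrictlyCoherent ∧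
      (thetaRayOfTwists G E α θ n).IsGaloisCountable :=
  thetaRay_isQuasiCoherent_isGaloisCountable G E α _ sG hsG sE hsE χ hχ hχα
    (thetaRayOfTwists_hlow G E α θ n hθ)

end Twists

end ProfiniteSemiGraph

end Literature.AnabelianGeometry.SemiGraphs
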